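import Summits.QuantumFields.YangMills.Theorems.BalabanUVNodesN06HstarJAtPinsWPhys
import Literature.MathematicalPhysics.QuantumFieldTheory.Balaban1983to89.B9Eq3126HTransposeCoords

/-!
# BalabanUVNodes ∕ N06 ([B9], `Dag.B9_main`) — THE TRANSPOSE LETTER `hHT` OF THE (H\*J) ROAD AT THE PINS: its `IsTransposePair` half DISCHARGED
# (`T′ := (C ∘ Q) ∘ G_D`, def-Y's dictionary) and its [4]-(2.51) majorant DERIVED from two displayed sup letters — Thm 3.12's `G_D` ((3.130)) and the
# WEIGHTED `C = (QGQ\*)⁻¹` ((3.132)) — plus n06-w5's Q-theorem and the member facts; hence ED.30's `hD2sup` at `𝔯 := resYOfC2 𝔠` from `hC2 + hreg + hGDsup + hCsup`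

Track A of `YM-PLAN.md` (cell `pub-ymgap`, HUMAN RULING D-0062), node **N06** = [Balaban1985BackgroundPropagators] Thms 3.1–3.15; WIDTH-209, seat
`pub-ymgap-dag-n06-w8` (g2′), 2026-08-28; CLAIM-6 = LOCATED-(B″) of this seat's lineage (F5–F9).  A HELPER for the stage-11 certificate editions ≥ 30 (binder
`hD2sup`) and for this seat's F8′ `…N06HstarJAtPinsWPhys` (binder `hHT`, weighted form).
WHAT.  F8′ (`…N06HstarJAtPinsWPhys`) derives the certificate's `(H\*J)`-road letters from a DISPLAYED transpose letter `hHT x U`: «`IsTransposePair (HcoK … (HDY … GpY …) U) (𝔗 x U)` ∧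
`HasMajorantHom (bI x ∘ fst) (fst) (𝔗 x U) (B_T·W_T x c·e^{−δ_T d})`».  THIS FILE supplies it at the EXPLICIT transpose family
`𝔗 x U := (CcoK … U ∘ₗ QcoKH … U) ∘ₗ GcoK … (GDY …) U` (F9 `B9Eq3126HTransposeCoords`): the first conjunct is a THEOREM at every `SU(N)`-valued `U`
(`isTransposePair_HcoK_HDY_parSymY`), the second follows (F9 `hasMajorantHom_CQG_of_letters`) from
* `hGDsup` — Thm 3.12's sup majorant of Sect. D's `G_D(U)` in n06-d's model currency: `HasMajorant (blkBK (bI x)) (GcoK … (GDY … GpY …) U) (r_G·e^{−(1−α)δ₀ d})`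
  (DISPLAYED; (3.130) at the pins is the knit's row-20 object);
* `hCsup` — (3.132) for `C(U)` WITH THE COARSE WEIGHT: `HasMajorant blkHK (CcoK … U) (r_C·W_C x a·e^{−δ₀ d})` (DISPLAYED; at the flat record `W_C = n_a`, the block
  count — n06-h «C-LETTER-FLAT-AT-ONE», def-Y (W2); the knit's `LettersHZ.c2` read out of its `bZ` class);
* the 1-faithful pin `hβ1` (certificate l.79), the member facts `q : PinPrims` ([4] (2.61) at `(δ₀, α)` above ONE threshold), `Reg335` (contracting transporters,
  `SU(N)`-valued `U`).
★★ `hHT_of_GD_C_letters` — output: `∃ M_T`, and above it F8′ (`…N06HstarJAtPinsWPhys`)'s `hHT` VERBATIM at `𝔗`, `W_T := W_C`, `B_T := r_C·c₁·(e^{δ₀(ℓ+4)}·c₁·1·r_G)`, `δ_T := (1−α)δ₀`.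
★★ `hHJ_of_GD_C_letters` — F8′ (`…N06HstarJAtPinsWPhys`) ∘ this: F6's `(H\*J)` binder `hHJ` at `w_H = W_C·(Lʲη)⁻³` from `hreg + hGDsup + hCsup` (+ pins, member facts, constants).
★★ `hD2sup_of_GD_C_letters` — F6 ∘ F8 ∘ this: edition 30's `hD2sup` at `𝔯 := resYOfC2 N θ M⋆ 𝔠` from `hC2 + hreg + hGDsup + hCsup` — the `hHJ` AND `hHT` letters
ELIMINATED; what stays displayed on this road: [5] (149) (`hC2`), the cube covering (`hreg`), Thm 3.12's `G_D` sup majorant, (3.132) weighted.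
HONEST FRAMING.  Kernel bookkeeping (transposes by def-Y's dictionary, [4] (2.51)∕(2.55)∕(2.61) by n06-w5's and the B6 engines, r06's (3.36) theorem); COUNT-NEUTRAL;
nothing of [B9]∕[5] asserted beyond displayed schemas; N06 NOT discharged; K1 NOT closed.  One finite 𝕋⁴ programme at fixed `ε` — NOT continuum, NOT OS,
NOT the mass gap ∕ Clay.  0 `def`, 0 `sorry`.
-/

noncomputable section

namespace Summit.QuantumFields.YangMills.BalabanUVNodes.N06HTransposeAtPinsPhys

open Literature.MathematicalPhysics.QuantumFieldTheory.Balaban1983to89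
open Literature.MathematicalPhysics.QuantumFieldTheory.Balaban1983to89.Node00 (CfgY FBondY IBondY GpY parSymY parBY trDualMatY trAdjY JY Stage3Params C2Y
  resYOfC2 etaBY)
open Literature.MathematicalPhysics.QuantumFieldTheory.Balaban1983to89.Node00.OpsYSectDCoords (QcoKH CcoK cR39_trBasis_pos)
open Literature.MathematicalPhysics.QuantumFieldTheory.Balaban1983to89.B9Eq3132SectDLetters (GDY HDY)
open Literature.MathematicalPhysics.QuantumFieldTheory.Balaban1983to89.B9Thm34Ext (toB6)
open Literature.MathematicalPhysics.QuantumFieldTheory.Balaban1983to89.B6RandomWalk (HasMajorant Ineq261)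
open Literature.MathematicalPhysics.QuantumFieldTheory.Balaban1983to89.B6RandomWalkHom (HasMajorantHom)
open Literature.MathematicalPhysics.QuantumFieldTheory.Balaban1983to89.B9Thm37Glue (IsTransposePair)
open Literature.MathematicalPhysics.QuantumFieldTheory.Balaban1983to89.B9RWSumsDefinitePins (PinPrims)
open Literature.MathematicalPhysics.QuantumFieldTheory.Balaban1983to89.B9RWSums347DefiniteFaces (exp261 lemma21Pack_geo9Y)
open Literature.MathematicalPhysics.QuantumFieldTheory.Balaban1983to89.B9RowSum261DefiniteFaces (rowConst261)
open Literature.MathematicalPhysics.QuantumFieldTheory.Balaban1983to89.B9PinMembersKLevelV1 (MemberY geo9Y bg9Y reg335Y_iff)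
open Literature.MathematicalPhysics.QuantumFieldTheory.Balaban1983to89.B9PinGeometryKLevelV1 (c35Y)
open Literature.MathematicalPhysics.QuantumFieldTheory.Balaban1983to89.B9GeoLemma21KLevelV1 (geo9Y_len_pos geo9Y_dist_triangle)
open Literature.MathematicalPhysics.QuantumFieldTheory.Balaban1983to89.B9BackgroundsKLevelV1 (shiftsV1 mem_of_reg335)
open Literature.MathematicalPhysics.QuantumFieldTheory.Balaban1983to89.B7Prop2SpecialUnitary (specialUnitaryUnits specialUnitaryUnits_le_unitaryUnits)
open Literature.MathematicalPhysics.QuantumFieldTheory.Balaban1983to89.B9CoReadingCoords (XBK blkBK GcoK)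
open Literature.MathematicalPhysics.QuantumFieldTheory.Balaban1983to89.B9CoReadingCoordsH (XHK blkHK HcoK)
open Literature.MathematicalPhysics.QuantumFieldTheory.Balaban1983to89.B9CoReadingCoordsTranspose (TrIdx trBasis)
open Literature.MathematicalPhysics.QuantumFieldTheory.Balaban1983to89.B9Thm39ReadingCoords (basisBound39)
open Literature.MathematicalPhysics.QuantumFieldTheory.Balaban1983to89.B9QstarLettersAtPins (parBY_norm_le_one_of_reg335)
open Literature.MathematicalPhysics.QuantumFieldTheory.Balaban1983to89.B9Eq336CurrentBound (RegularAt)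
open Literature.MathematicalPhysics.QuantumFieldTheory.Balaban1983to89.B6GlobalChartV1 (PV blkV1)
open Literature.MathematicalPhysics.QuantumFieldTheory.Balaban1983to89.B6Ineq2142KLevelV1 (β)
open Literature.MathematicalPhysics.QuantumFieldTheory.Balaban1983to89.B6Geom246MultiLevelTorus (geomT)
open Literature.MathematicalPhysics.QuantumFieldTheory.Balaban1983to89.B9GeoNormsKLevelV1 (geo9K)
open Literature.MathematicalPhysics.QuantumFieldTheory.Balaban1983to89.B9Eq3126HTransposeCoords (isTransposePair_HcoK_HDY_parSymY hasMajorantHom_CQG_of_letters)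
open Summit.QuantumFields.YangMills.BalabanUVNodes.N06HstarJAtPinsWPhys (hHJ_of_transpose_schemas_w hD2sup_of_transpose_schemas_w)
open scoped Matrix.Norms.L2Operator

variable {N : ℕ} [NeZero N] {θ : Stage3Params} {Mstar : ℕ}
variable [∀ x : MemberY θ.d₆ θ.ℓ₆ θ.hd' θ.hL' θ.b₀ θ.b₁ Mstar, Fintype (geo9Y x).Site]

/-- ★★ **F8′ (`…N06HstarJAtPinsWPhys`)'s TRANSPOSE LETTER `hHT` AT THE EXPLICIT FAMILY `𝔗 := (C ∘ Q) ∘ G_D`, FROM THE `G_D` AND WEIGHTED-`C` SUP LETTERS** (module docstring): above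
ONE threshold and in the regime, (i) `IsTransposePair (HcoK … (HDY … GpY …) U) ((CcoK … U ∘ₗ QcoKH … U) ∘ₗ GcoK … (GDY …) U)` (a THEOREM at `SU(N)`-valued
`U`) and (ii) its [4]-(2.51) majorant `r_C·c₁·W_C(c)·(e^{δ₀(ℓ+4)}·c₁·1·r_G)·e^{−(1−α)δ₀ d(c,y′)}` from the fine carrier (blocks `bI x`) to the coarse one.
[cite: Balaban1985BackgroundPropagators, (3.126) p.420, (3.130) p.421, (3.132)–(3.133) p.422, (3.12)–(3.14) p.393, Thm 3.11 p.416; Balaban1984PropagatorsII, (2.51)–(2.56) pp.232–233, Lemma 2.1 (2.61) p.234] -/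
theorem hHT_of_GD_C_letters (q : PinPrims) (hq : q.OK) (H : MemberY θ.d₆ θ.ℓ₆ θ.hd' θ.hL' θ.b₀ θ.b₁ Mstar → Prop)
    (bI : ∀ x : MemberY θ.d₆ θ.ℓ₆ θ.hd' θ.hL' θ.b₀ θ.b₁ Mstar, FBondY x.toKIdx → IBondY x.toKIdx)
    (hβ1 : ∀ (x : MemberY θ.d₆ θ.ℓ₆ θ.hd' θ.hL' θ.b₀ θ.b₁ Mstar) (f : FBondY x.toKIdx), (geomT x.D).dist (β x.hN x.D x.hk (bI x f)) (blkV1 x.hN x.D f) ≤ 1)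
    (WC : ∀ x : MemberY θ.d₆ θ.ℓ₆ θ.hd' θ.hL' θ.b₀ θ.b₁ Mstar, IBondY x.toKIdx → ℝ) (hWC : ∀ x c, 0 ≤ WC x c)
    (rG rC M a : ℝ) (hrG : 0 ≤ rG) (hrC : 0 ≤ rC)
    (hGDsup : ∀ x : MemberY θ.d₆ θ.ℓ₆ θ.hd' θ.hL' θ.b₀ θ.b₁ Mstar, M ≤ (geo9Y x).M → ∀ α₀ : ℝ, 0 < α₀ → (geo9Y x).M * α₀ ≤ a →
      ∀ U : (bg9Y (Matrix (Fin N) (Fin N) ℂ) (specialUnitaryUnits (Fin N)) x).Cfg,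
        (bg9Y (Matrix (Fin N) (Fin N) ℂ) (specialUnitaryUnits (Fin N)) x).Reg335 c35Y α₀ U →
        (bg9Y (Matrix (Fin N) (Fin N) ℂ) (specialUnitaryUnits (Fin N)) x).Reg336 c35Y α₀ U →
          HasMajorant (g := toB6 (geo9Y x) 1 (H x)) (blkBK x.toKIdx (bI x))
            (GcoK x.toKIdx (trBasis N) (bg9Y (Matrix (Fin N) (Fin N) ℂ) (specialUnitaryUnits (Fin N)) x) (fun U => U)
              (GDY x.toKIdx (parSymY x.toKIdx) (parBY x.toKIdx) (GpY x.toKIdx (parSymY x.toKIdx))) U)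
            (fun a b => rG * Real.exp (-((1 - q.α) * q.δ₀ * (geo9Y x).dist a b))))
    (hCsup : ∀ x : MemberY θ.d₆ θ.ℓ₆ θ.hd' θ.hL' θ.b₀ θ.b₁ Mstar, M ≤ (geo9Y x).M → ∀ α₀ : ℝ, 0 < α₀ → (geo9Y x).M * α₀ ≤ a →
      ∀ U : (bg9Y (Matrix (Fin N) (Fin N) ℂ) (specialUnitaryUnits (Fin N)) x).Cfg,
        (bg9Y (Matrix (Fin N) (Fin N) ℂ) (specialUnitaryUnits (Fin N)) x).Reg335 c35Y α₀ U →
        (bg9Y (Matrix (Fin N) (Fin N) ℂ) (specialUnitaryUnits (Fin N)) x).Reg336 c35Y α₀ U →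
          HasMajorant (g := toB6 (geo9Y x) 1 (H x)) (blkHK x.toKIdx)
            (CcoK x.toKIdx (trBasis N) (bg9Y (Matrix (Fin N) (Fin N) ℂ) (specialUnitaryUnits (Fin N)) x) (fun U => U)
              (parSymY x.toKIdx) (parBY x.toKIdx) (GpY x.toKIdx (parSymY x.toKIdx)) U)
            (fun a b => rC * WC x a * Real.exp (-(q.δ₀ * (geo9Y x).dist a b)))) :
    ∃ MT : ℝ, ∀ x : MemberY θ.d₆ θ.ℓ₆ θ.hd' θ.hL' θ.b₀ θ.b₁ Mstar, MT ≤ (geo9Y x).M → M ≤ (geo9Y x).M → ∀ α₀ : ℝ, 0 < α₀ → (geo9Y x).M * α₀ ≤ a →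
      ∀ U : (bg9Y (Matrix (Fin N) (Fin N) ℂ) (specialUnitaryUnits (Fin N)) x).Cfg,
        (bg9Y (Matrix (Fin N) (Fin N) ℂ) (specialUnitaryUnits (Fin N)) x).Reg335 c35Y α₀ U →
        (bg9Y (Matrix (Fin N) (Fin N) ℂ) (specialUnitaryUnits (Fin N)) x).Reg336 c35Y α₀ U →
          IsTransposePair (HcoK x.toKIdx (trBasis N) (bg9Y (Matrix (Fin N) (Fin N) ℂ) (specialUnitaryUnits (Fin N)) x) (fun U => U)
              (HDY x.toKIdx (parSymY x.toKIdx) (parBY x.toKIdx) (GpY x.toKIdx (parSymY x.toKIdx))) U)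
            ((CcoK x.toKIdx (trBasis N) (bg9Y (Matrix (Fin N) (Fin N) ℂ) (specialUnitaryUnits (Fin N)) x) (fun U => U)
                (parSymY x.toKIdx) (parBY x.toKIdx) (GpY x.toKIdx (parSymY x.toKIdx)) U ∘ₗ
              QcoKH x.toKIdx (trBasis N) (bg9Y (Matrix (Fin N) (Fin N) ℂ) (specialUnitaryUnits (Fin N)) x) (fun U => U) (parBY x.toKIdx) U) ∘ₗ
              GcoK x.toKIdx (trBasis N) (bg9Y (Matrix (Fin N) (Fin N) ℂ) (specialUnitaryUnits (Fin N)) x) (fun U => U)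
                (GDY x.toKIdx (parSymY x.toKIdx) (parBY x.toKIdx) (GpY x.toKIdx (parSymY x.toKIdx))) U) ∧
            HasMajorantHom (g := toB6 (geo9Y x) 1 (H x)) (fun p : XBK (TrIdx N) x.toKIdx => bI x p.1) (fun p : XHK (TrIdx N) x.toKIdx => p.1)
              ((CcoK x.toKIdx (trBasis N) (bg9Y (Matrix (Fin N) (Fin N) ℂ) (specialUnitaryUnits (Fin N)) x) (fun U => U)
                  (parSymY x.toKIdx) (parBY x.toKIdx) (GpY x.toKIdx (parSymY x.toKIdx)) U ∘ₗ
                QcoKH x.toKIdx (trBasis N) (bg9Y (Matrix (Fin N) (Fin N) ℂ) (specialUnitaryUnits (Fin N)) x) (fun U => U) (parBY x.toKIdx) U) ∘ₗ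
                GcoK x.toKIdx (trBasis N) (bg9Y (Matrix (Fin N) (Fin N) ℂ) (specialUnitaryUnits (Fin N)) x) (fun U => U)
                  (GDY x.toKIdx (parSymY x.toKIdx) (parBY x.toKIdx) (GpY x.toKIdx (parSymY x.toKIdx))) U)
              (fun c y' => (rC * B6.c1 (exp261 (@geo9Y θ.d₆ θ.ℓ₆ θ.hd' θ.hL' θ.b₀ θ.b₁ Mstar) q.δ₀ q.α) q.δ₀ q.α *
                  (Real.exp (q.δ₀ * ((θ.ℓ₆ : ℝ) + 4)) * B6.c1 (exp261 (@geo9Y θ.d₆ θ.ℓ₆ θ.hd' θ.hL' θ.b₀ θ.b₁ Mstar) q.δ₀ q.α) q.δ₀ q.α * 1 * rG)) *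
                WC x c * Real.exp (-((1 - q.α) * q.δ₀ * (geo9Y x).dist c y'))) := by
  obtain ⟨Mth, h261, -, -⟩ :=
    lemma21Pack_geo9Y (d := θ.d₆) (ℓ := θ.ℓ₆) (hd := θ.hd') (hL := θ.hL') (b₀ := θ.b₀) (b₁ := θ.b₁) (Mstar := Mstar) H hq.α_pos hq.α_lt
      hq.δ₀_pos hq.αF_pos (by linarith only [hq.αF_lt])
  have hN : 0 < N := Nat.pos_of_ne_zero (NeZero.ne N)
  refine ⟨Mth, fun x hMx hMM α₀ hα ha U hU hU' => ?_⟩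
  have hGv : ∀ μ z, U μ z ∈ specialUnitaryUnits (Fin N) := mem_of_reg335 x.toKIdx ((reg335Y_iff x c35Y α₀ U).1 hU).1
  refine ⟨isTransposePair_HcoK_HDY_parSymY x.toKIdx (bg9Y (Matrix (Fin N) (Fin N) ℂ) (specialUnitaryUnits (Fin N)) x) (fun U => U)
    specialUnitaryUnits_le_unitaryUnits hN U hGv, ?_⟩
  letI : Fintype (geo9K x.toKIdx).Site := (inferInstance : Fintype (geo9Y x).Site)
  have htri : B6RandomWalk.Triangle254 (toB6 (geo9K x.toKIdx) 1 (H x)) := fun a b c => geo9Y_dist_triangle x a b c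
  have hαδ : 0 ≤ (1 - q.α) * q.δ₀ := mul_nonneg (by linarith only [hq.α_lt]) hq.δ₀_pos.le
  have h := hasMajorantHom_CQG_of_letters (R₀ := 1) (H₀ := H x) x.toKIdx (bg9Y (Matrix (Fin N) (Fin N) ℂ) (specialUnitaryUnits (Fin N)) x) (fun U => U)
    (hβ1 x) U (parBY_norm_le_one_of_reg335 x hU) htri hq.δ₀_pos.le hαδ hrG hrC (hWC x) (h261 x hMx)
    (hGDsup x hMM α₀ hα ha U hU hU') (hCsup x hMM α₀ hα ha U hU hU')
  refine B6RandomWalkHom.hasMajorantHom_mono _ _ h fun a b => le_of_eq ?_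
  have hd : (geo9Y x).dist a b = (geo9K x.toKIdx).dist a b := rfl
  rw [hd]
  ring

/-- the explicit transpose family's constant is nonnegative. [cite: Balaban1984PropagatorsII, Lemma 2.1 (2.61) p.234, bookkeeping] -/
private theorem BT_nonneg (q : PinPrims) (hq : q.OK) {rG rC : ℝ} (hrG : 0 ≤ rG) (hrC : 0 ≤ rC) :
    0 ≤ rC * B6.c1 (exp261 (@geo9Y θ.d₆ θ.ℓ₆ θ.hd' θ.hL' θ.b₀ θ.b₁ Mstar) q.δ₀ q.α) q.δ₀ q.α *
      (Real.exp (q.δ₀ * ((θ.ℓ₆ : ℝ) + 4)) * B6.c1 (exp261 (@geo9Y θ.d₆ θ.ℓ₆ θ.hd' θ.hL' θ.b₀ θ.b₁ Mstar) q.δ₀ q.α) q.δ₀ q.α * 1 * rG) := by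
  have h := B6RandomWalk.c1_nonneg (exp261 (@geo9Y θ.d₆ θ.ℓ₆ θ.hd' θ.hL' θ.b₀ θ.b₁ Mstar) q.δ₀ q.α) q.δ₀ q.α
  have _ := hq.δ₀_pos
  positivity

/-- ★★ **F6's `(H\*J)` LETTER `hHJ` FROM `hreg + hGDsup + hCsup`** (F8′ (`…N06HstarJAtPinsWPhys`) `hHJ_of_transpose_schemas_w` ∘ `hHT_of_GD_C_letters`): in the regime and above ONE
threshold, `‖(H(U)†J(U))(c)‖ ≦ t_{HJ}·(M_xα₀)·(W_C(c)·((Lʲη)_c³)⁻¹)` for def-Y's `H(U) = HDY … (GpY …) U`, `J(U) = JY … U`, from: regularity at every fine bond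
(`hreg`, DISPLAYED), Thm 3.12's `G_D` sup letter (`hGDsup`, DISPLAYED), the weighted (3.132) letter (`hCsup`, DISPLAYED), the pins `hbI0 ∕ hβ1`, the member facts, the
rate budget `α_F(1−2α)δ₀ + ρ_R ≦ (1−α)δ₀` and ONE constant `t_{HJ} ≧ N𝔟²·(10⁴(d+1)c_J)·((d+1)·#κ·B_T)·(ℓ+1)³·rowConst261 geo9Y ρ_R`, `B_T` the explicit transpose
constant. [cite: Balaban1985BackgroundPropagators, p.422 (the sentence between (3.136) and (3.137)), (3.126) p.420, (3.130) p.421, (3.132)–(3.133) p.422, (3.36) p.396; Balaban1984PropagatorsII, (2.51) p.232, Lemma 2.1 (2.60)–(2.61) pp.233–234] -/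
theorem hHJ_of_GD_C_letters (q : PinPrims) (hq : q.OK) (H : MemberY θ.d₆ θ.ℓ₆ θ.hd' θ.hL' θ.b₀ θ.b₁ Mstar → Prop)
    (bI : ∀ x : MemberY θ.d₆ θ.ℓ₆ θ.hd' θ.hL' θ.b₀ θ.b₁ Mstar, FBondY x.toKIdx → IBondY x.toKIdx)
    (hbI0 : ∀ (x : MemberY θ.d₆ θ.ℓ₆ θ.hd' θ.hL' θ.b₀ θ.b₁ Mstar) (f : FBondY x.toKIdx), bI x f = bI x ⟨f.src, 0⟩)
    (hβ1 : ∀ (x : MemberY θ.d₆ θ.ℓ₆ θ.hd' θ.hL' θ.b₀ θ.b₁ Mstar) (f : FBondY x.toKIdx), (geomT x.D).dist (β x.hN x.D x.hk (bI x f)) (blkV1 x.hN x.D f) ≤ 1)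
    (WC : ∀ x : MemberY θ.d₆ θ.ℓ₆ θ.hd' θ.hL' θ.b₀ θ.b₁ Mstar, IBondY x.toKIdx → ℝ) (hWC : ∀ x c, 0 ≤ WC x c)
    (rG rC cJ ρR tHJ M a : ℝ) (hrG : 0 ≤ rG) (hrC : 0 ≤ rC) (hcJ : 0 ≤ cJ) (hρR : 0 < ρR) (hM : 0 < M) (ha1 : cJ * a ≤ 1)
    (hρ : q.αF * ((1 - 2 * q.α) * q.δ₀) + ρR ≤ (1 - q.α) * q.δ₀)
    (htHJ : N * basisBound39 (trBasis N) ^ 2 * (10 ^ 4 * ((θ.d₆ : ℝ) + 1) * cJ) *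
      (((θ.d₆ : ℝ) + 1) * Fintype.card (TrIdx N) *
        (rC * B6.c1 (exp261 (@geo9Y θ.d₆ θ.ℓ₆ θ.hd' θ.hL' θ.b₀ θ.b₁ Mstar) q.δ₀ q.α) q.δ₀ q.α *
          (Real.exp (q.δ₀ * ((θ.ℓ₆ : ℝ) + 4)) * B6.c1 (exp261 (@geo9Y θ.d₆ θ.ℓ₆ θ.hd' θ.hL' θ.b₀ θ.b₁ Mstar) q.δ₀ q.α) q.δ₀ q.α * 1 * rG))) *
      ((((θ.ℓ₆ + 1 : ℕ) : ℝ) ^ 3) * rowConst261 (geo9Y (d := θ.d₆) (ℓ := θ.ℓ₆) (hd := θ.hd') (hL := θ.hL') (b₀ := θ.b₀) (b₁ := θ.b₁) (Mstar := Mstar)) ρR) ≤ tHJ)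
    (hGDsup : ∀ x : MemberY θ.d₆ θ.ℓ₆ θ.hd' θ.hL' θ.b₀ θ.b₁ Mstar, M ≤ (geo9Y x).M → ∀ α₀ : ℝ, 0 < α₀ → (geo9Y x).M * α₀ ≤ a →
      ∀ U : (bg9Y (Matrix (Fin N) (Fin N) ℂ) (specialUnitaryUnits (Fin N)) x).Cfg,
        (bg9Y (Matrix (Fin N) (Fin N) ℂ) (specialUnitaryUnits (Fin N)) x).Reg335 c35Y α₀ U →
        (bg9Y (Matrix (Fin N) (Fin N) ℂ) (specialUnitaryUnits (Fin N)) x).Reg336 c35Y α₀ U →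
          HasMajorant (g := toB6 (geo9Y x) 1 (H x)) (blkBK x.toKIdx (bI x))
            (GcoK x.toKIdx (trBasis N) (bg9Y (Matrix (Fin N) (Fin N) ℂ) (specialUnitaryUnits (Fin N)) x) (fun U => U)
              (GDY x.toKIdx (parSymY x.toKIdx) (parBY x.toKIdx) (GpY x.toKIdx (parSymY x.toKIdx))) U)
            (fun a b => rG * Real.exp (-((1 - q.α) * q.δ₀ * (geo9Y x).dist a b))))
    (hCsup : ∀ x : MemberY θ.d₆ θ.ℓ₆ θ.hd' θ.hL' θ.b₀ θ.b₁ Mstar, M ≤ (geo9Y x).M → ∀ α₀ : ℝ, 0 < α₀ → (geo9Y x).M * α₀ ≤ a →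
      ∀ U : (bg9Y (Matrix (Fin N) (Fin N) ℂ) (specialUnitaryUnits (Fin N)) x).Cfg,
        (bg9Y (Matrix (Fin N) (Fin N) ℂ) (specialUnitaryUnits (Fin N)) x).Reg335 c35Y α₀ U →
        (bg9Y (Matrix (Fin N) (Fin N) ℂ) (specialUnitaryUnits (Fin N)) x).Reg336 c35Y α₀ U →
          HasMajorant (g := toB6 (geo9Y x) 1 (H x)) (blkHK x.toKIdx)
            (CcoK x.toKIdx (trBasis N) (bg9Y (Matrix (Fin N) (Fin N) ℂ) (specialUnitaryUnits (Fin N)) x) (fun U => U)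
              (parSymY x.toKIdx) (parBY x.toKIdx) (GpY x.toKIdx (parSymY x.toKIdx)) U)
            (fun a b => rC * WC x a * Real.exp (-(q.δ₀ * (geo9Y x).dist a b))))
    (hreg : ∀ x : MemberY θ.d₆ θ.ℓ₆ θ.hd' θ.hL' θ.b₀ θ.b₁ Mstar, M ≤ (geo9Y x).M → ∀ α₀ : ℝ, 0 < α₀ → (geo9Y x).M * α₀ ≤ a →
      ∀ U : (bg9Y (Matrix (Fin N) (Fin N) ℂ) (specialUnitaryUnits (Fin N)) x).Cfg,
        (bg9Y (Matrix (Fin N) (Fin N) ℂ) (specialUnitaryUnits (Fin N)) x).Reg335 c35Y α₀ U →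
        (bg9Y (Matrix (Fin N) (Fin N) ℂ) (specialUnitaryUnits (Fin N)) x).Reg336 c35Y α₀ U →
          ∀ μ s, RegularAt (shiftsV1 (PV θ.d₆ θ.ℓ₆ x.toKIdx.m x.toKIdx.K θ.hd' θ.hL')) U (etaBY x.toKIdx)
            (cJ * ((geo9Y x).M * α₀)) ((geo9Y x).len (bI x ⟨s, 0⟩)) μ s) :
    ∃ MH : ℝ, ∀ x : MemberY θ.d₆ θ.ℓ₆ θ.hd' θ.hL' θ.b₀ θ.b₁ Mstar, MH ≤ (geo9Y x).M → M ≤ (geo9Y x).M → ∀ α₀ : ℝ, 0 < α₀ → (geo9Y x).M * α₀ ≤ a →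
      ∀ U : (bg9Y (Matrix (Fin N) (Fin N) ℂ) (specialUnitaryUnits (Fin N)) x).Cfg,
        (bg9Y (Matrix (Fin N) (Fin N) ℂ) (specialUnitaryUnits (Fin N)) x).Reg335 c35Y α₀ U →
        (bg9Y (Matrix (Fin N) (Fin N) ℂ) (specialUnitaryUnits (Fin N)) x).Reg336 c35Y α₀ U →
          ∀ c : IBondY x.toKIdx,
            ‖trAdjY (trDualMatY N) (HDY x.toKIdx (parSymY x.toKIdx) (parBY x.toKIdx) (GpY x.toKIdx (parSymY x.toKIdx)) U) (JY x.toKIdx U) c‖ ≤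
              tHJ * ((geo9Y x).M * α₀) * (WC x c * ((geo9Y x).len c ^ 3)⁻¹) := by
  obtain ⟨MT, hHT⟩ := hHT_of_GD_C_letters q hq H bI hβ1 WC hWC rG rC M a hrG hrC hGDsup hCsup
  have hM' : 0 < max M MT := lt_max_of_lt_left hM
  obtain ⟨MH, hHJ⟩ := hHJ_of_transpose_schemas_w q hq H bI hbI0
    (fun x U => (CcoK x.toKIdx (trBasis N) (bg9Y (Matrix (Fin N) (Fin N) ℂ) (specialUnitaryUnits (Fin N)) x) (fun U => U)
        (parSymY x.toKIdx) (parBY x.toKIdx) (GpY x.toKIdx (parSymY x.toKIdx)) U ∘ₗ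
      QcoKH x.toKIdx (trBasis N) (bg9Y (Matrix (Fin N) (Fin N) ℂ) (specialUnitaryUnits (Fin N)) x) (fun U => U) (parBY x.toKIdx) U) ∘ₗ
      GcoK x.toKIdx (trBasis N) (bg9Y (Matrix (Fin N) (Fin N) ℂ) (specialUnitaryUnits (Fin N)) x) (fun U => U)
        (GDY x.toKIdx (parSymY x.toKIdx) (parBY x.toKIdx) (GpY x.toKIdx (parSymY x.toKIdx))) U)
    WC hWC cJ _ ((1 - q.α) * q.δ₀) ρR tHJ (max M MT) a hcJ (BT_nonneg q hq hrG hrC) hρR hM' ha1 hρ htHJ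
    (fun x hMx α₀ hα ha U hU hU' => hHT x ((le_max_right _ _).trans hMx) ((le_max_left _ _).trans hMx) α₀ hα ha U hU hU')
    (fun x hMx α₀ hα ha U hU hU' => hreg x ((le_max_left _ _).trans hMx) α₀ hα ha U hU hU')
  exact ⟨max MH MT, fun x hMx hMM α₀ hα ha U hU hU' c =>
    hHJ x ((le_max_left _ _).trans hMx) (max_le hMM ((le_max_right _ _).trans hMx)) α₀ hα ha U hU hU' c⟩

/-- ★★ **EDITION 30's `hD2sup` AT `𝔯 := resYOfC2 N θ M⋆ 𝔠` FROM `hC2 + hreg + hGDsup + hCsup`** (F6 `hD2sup_of_form_schemas_w` ∘ F8′ (`…N06HstarJAtPinsWPhys`) ∘ `hHT_of_GD_C_letters`):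
the `(H\*J)` letter `hHJ` AND the transpose letter `hHT` ELIMINATED; what stays displayed on this road is [5] (149) (`hC2`, weight `w_C` with
`w_C·W_C·(Lʲη)⁻³ ≦ (Lʲη)⁻²`), the cube covering (`hreg`), Thm 3.12's `G_D` sup letter (`hGDsup`) and the weighted (3.132) letter (`hCsup`).  (Edition 29's
`hD2L2` follows the same way through F8′ (`…N06HstarJAtPinsWPhys`)'s `hD2L2_of_transpose_schemas_w` with def-Y's reality letters `hC hH`.)
[cite: Balaban1985BackgroundPropagators, (3.136)–(3.137) pp.422–423, (3.134) p.422, (3.126) p.420, (3.130) p.421, (3.132)–(3.133) p.422, (3.36) p.396, p.398; Balaban1985Averaging, (149) p.40; Balaban1984PropagatorsII, (2.51) p.232, (2.54), (2.60)–(2.61) pp.233–234] -/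
theorem hD2sup_of_GD_C_letters (q : PinPrims) (hq : q.OK) (H : MemberY θ.d₆ θ.ℓ₆ θ.hd' θ.hL' θ.b₀ θ.b₁ Mstar → Prop) (𝔠 : C2Y N θ Mstar)
    (𝔬12 : ∀ x : MemberY θ.d₆ θ.ℓ₆ θ.hd' θ.hL' θ.b₀ θ.b₁ Mstar, B9Thm312Whole.Ops (geo9Y x) (bg9Y (Matrix (Fin N) (Fin N) ℂ) (specialUnitaryUnits (Fin N)) x)
      (XBK (TrIdx N) x.toKIdx) (XBK (TrIdx N) x.toKIdx) (XHK (TrIdx N) x.toKIdx) (B9CoReadingCoordsS.XSK (TrIdx N) x.toKIdx))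
    (bI : ∀ x : MemberY θ.d₆ θ.ℓ₆ θ.hd' θ.hL' θ.b₀ θ.b₁ Mstar, FBondY x.toKIdx → IBondY x.toKIdx)
    (hbI0 : ∀ (x : MemberY θ.d₆ θ.ℓ₆ θ.hd' θ.hL' θ.b₀ θ.b₁ Mstar) (f : FBondY x.toKIdx), bI x f = bI x ⟨f.src, 0⟩)
    (hβ1 : ∀ (x : MemberY θ.d₆ θ.ℓ₆ θ.hd' θ.hL' θ.b₀ θ.b₁ Mstar) (f : FBondY x.toKIdx), (geomT x.D).dist (β x.hN x.D x.hk (bI x f)) (blkV1 x.hN x.D f) ≤ 1)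
    (hblk12 : ∀ x : MemberY θ.d₆ θ.ℓ₆ θ.hd' θ.hL' θ.b₀ θ.b₁ Mstar, (𝔬12 x).blk = blkBK x.toKIdx (bI x))
    (wC WC : ∀ x : MemberY θ.d₆ θ.ℓ₆ θ.hd' θ.hL' θ.b₀ θ.b₁ Mstar, IBondY x.toKIdx → ℝ) (hwC : ∀ x c, 0 ≤ wC x c) (hWC : ∀ x c, 0 ≤ WC x c)
    (hww : ∀ x c, wC x c * (WC x c * ((geo9Y x).len c ^ 3)⁻¹) ≤ ((geo9Y x).len c ^ 2)⁻¹)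
    (κC δC rG rC cJ ρR tHJ δ₂ θ₂ M a : ℝ) (hκC : 0 ≤ κC) (hrG : 0 ≤ rG) (hrC : 0 ≤ rC) (hcJ : 0 ≤ cJ) (hρR : 0 < ρR) (hδ₂ : 0 ≤ δ₂) (hM : 0 < M)
    (ha1 : cJ * a ≤ 1) (hδC : δ₂ + q.αF * ((1 - 2 * q.α) * q.δ₀) + ρR ≤ δC) (hρ : q.αF * ((1 - 2 * q.α) * q.δ₀) + ρR ≤ (1 - q.α) * q.δ₀)
    (htHJ : N * basisBound39 (trBasis N) ^ 2 * (10 ^ 4 * ((θ.d₆ : ℝ) + 1) * cJ) *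
      (((θ.d₆ : ℝ) + 1) * Fintype.card (TrIdx N) *
        (rC * B6.c1 (exp261 (@geo9Y θ.d₆ θ.ℓ₆ θ.hd' θ.hL' θ.b₀ θ.b₁ Mstar) q.δ₀ q.α) q.δ₀ q.α *
          (Real.exp (q.δ₀ * ((θ.ℓ₆ : ℝ) + 4)) * B6.c1 (exp261 (@geo9Y θ.d₆ θ.ℓ₆ θ.hd' θ.hL' θ.b₀ θ.b₁ Mstar) q.δ₀ q.α) q.δ₀ q.α * 1 * rG))) *
      ((((θ.ℓ₆ + 1 : ℕ) : ℝ) ^ 3) * rowConst261 (geo9Y (d := θ.d₆) (ℓ := θ.ℓ₆) (hd := θ.hd') (hL := θ.hL') (b₀ := θ.b₀) (b₁ := θ.b₁) (Mstar := Mstar)) ρR) ≤ tHJ)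
    (hθ₂ : (B9Thm39ReadingCoords.cR39 (trBasis N))⁻¹ * (2 * N * basisBound39 (trBasis N) ^ 2 * κC * tHJ * (((θ.ℓ₆ + 1 : ℕ) : ℝ) ^ 2) *
      rowConst261 (geo9Y (d := θ.d₆) (ℓ := θ.ℓ₆) (hd := θ.hd') (hL := θ.hL') (b₀ := θ.b₀) (b₁ := θ.b₁) (Mstar := Mstar)) ρR) ≤ θ₂)
    (hC2 : ∀ x : MemberY θ.d₆ θ.ℓ₆ θ.hd' θ.hL' θ.b₀ θ.b₁ Mstar, M ≤ (geo9Y x).M → ∀ α₀ : ℝ, 0 < α₀ → (geo9Y x).M * α₀ ≤ a →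
      ∀ U : (bg9Y (Matrix (Fin N) (Fin N) ℂ) (specialUnitaryUnits (Fin N)) x).Cfg,
        (bg9Y (Matrix (Fin N) (Fin N) ℂ) (specialUnitaryUnits (Fin N)) x).Reg335 c35Y α₀ U →
        (bg9Y (Matrix (Fin N) (Fin N) ℂ) (specialUnitaryUnits (Fin N)) x).Reg336 c35Y α₀ U →
          B9Delta2FormMajorant.C2FormMaj x.toKIdx (g := geo9Y x) (bI x) (fun c => c) (𝔠 x).form U κC δC (wC x))
    (hGDsup : ∀ x : MemberY θ.d₆ θ.ℓ₆ θ.hd' θ.hL' θ.b₀ θ.b₁ Mstar, M ≤ (geo9Y x).M → ∀ α₀ : ℝ, 0 < α₀ → (geo9Y x).M * α₀ ≤ a →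
      ∀ U : (bg9Y (Matrix (Fin N) (Fin N) ℂ) (specialUnitaryUnits (Fin N)) x).Cfg,
        (bg9Y (Matrix (Fin N) (Fin N) ℂ) (specialUnitaryUnits (Fin N)) x).Reg335 c35Y α₀ U →
        (bg9Y (Matrix (Fin N) (Fin N) ℂ) (specialUnitaryUnits (Fin N)) x).Reg336 c35Y α₀ U →
          HasMajorant (g := toB6 (geo9Y x) 1 (H x)) (blkBK x.toKIdx (bI x))
            (GcoK x.toKIdx (trBasis N) (bg9Y (Matrix (Fin N) (Fin N) ℂ) (specialUnitaryUnits (Fin N)) x) (fun U => U)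
              (GDY x.toKIdx (parSymY x.toKIdx) (parBY x.toKIdx) (GpY x.toKIdx (parSymY x.toKIdx))) U)
            (fun a b => rG * Real.exp (-((1 - q.α) * q.δ₀ * (geo9Y x).dist a b))))
    (hCsup : ∀ x : MemberY θ.d₆ θ.ℓ₆ θ.hd' θ.hL' θ.b₀ θ.b₁ Mstar, M ≤ (geo9Y x).M → ∀ α₀ : ℝ, 0 < α₀ → (geo9Y x).M * α₀ ≤ a →
      ∀ U : (bg9Y (Matrix (Fin N) (Fin N) ℂ) (specialUnitaryUnits (Fin N)) x).Cfg,
        (bg9Y (Matrix (Fin N) (Fin N) ℂ) (specialUnitaryUnits (Fin N)) x).Reg335 c35Y α₀ U →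
        (bg9Y (Matrix (Fin N) (Fin N) ℂ) (specialUnitaryUnits (Fin N)) x).Reg336 c35Y α₀ U →
          HasMajorant (g := toB6 (geo9Y x) 1 (H x)) (blkHK x.toKIdx)
            (CcoK x.toKIdx (trBasis N) (bg9Y (Matrix (Fin N) (Fin N) ℂ) (specialUnitaryUnits (Fin N)) x) (fun U => U)
              (parSymY x.toKIdx) (parBY x.toKIdx) (GpY x.toKIdx (parSymY x.toKIdx)) U)
            (fun a b => rC * WC x a * Real.exp (-(q.δ₀ * (geo9Y x).dist a b))))
    (hreg : ∀ x : MemberY θ.d₆ θ.ℓ₆ θ.hd' θ.hL' θ.b₀ θ.b₁ Mstar, M ≤ (geo9Y x).M → ∀ α₀ : ℝ, 0 < α₀ → (geo9Y x).M * α₀ ≤ a →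
      ∀ U : (bg9Y (Matrix (Fin N) (Fin N) ℂ) (specialUnitaryUnits (Fin N)) x).Cfg,
        (bg9Y (Matrix (Fin N) (Fin N) ℂ) (specialUnitaryUnits (Fin N)) x).Reg335 c35Y α₀ U →
        (bg9Y (Matrix (Fin N) (Fin N) ℂ) (specialUnitaryUnits (Fin N)) x).Reg336 c35Y α₀ U →
          ∀ μ s, RegularAt (shiftsV1 (PV θ.d₆ θ.ℓ₆ x.toKIdx.m x.toKIdx.K θ.hd' θ.hL')) U (etaBY x.toKIdx)
            (cJ * ((geo9Y x).M * α₀)) ((geo9Y x).len (bI x ⟨s, 0⟩)) μ s) :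
    ∃ ML : ℝ, ∀ x : MemberY θ.d₆ θ.ℓ₆ θ.hd' θ.hL' θ.b₀ θ.b₁ Mstar, ML ≤ (geo9Y x).M → M ≤ (geo9Y x).M → ∀ α₀ : ℝ, 0 < α₀ → (geo9Y x).M * α₀ ≤ a →
      ∀ U : (bg9Y (Matrix (Fin N) (Fin N) ℂ) (specialUnitaryUnits (Fin N)) x).Cfg,
        (bg9Y (Matrix (Fin N) (Fin N) ℂ) (specialUnitaryUnits (Fin N)) x).Reg335 c35Y α₀ U →
        (bg9Y (Matrix (Fin N) (Fin N) ℂ) (specialUnitaryUnits (Fin N)) x).Reg336 c35Y α₀ U →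
          HasMajorant (g := toB6 (geo9Y x) 1 (H x)) (𝔬12 x).blk
            (B9PerturbationL2Delta2.D2coK x.toKIdx (trBasis N) (bg9Y (Matrix (Fin N) (Fin N) ℂ) (specialUnitaryUnits (Fin N)) x) (fun U => U)
              ((resYOfC2 N θ Mstar 𝔠 x).Δ2) U)
            (fun (a b : (geo9Y x).Site) => θ₂ * ((geo9Y x).M * α₀) * ((geo9Y x).len a ^ 2)⁻¹ * Real.exp (-(δ₂ * (geo9Y x).dist a b))) := by
  obtain ⟨MT, hHT⟩ := hHT_of_GD_C_letters q hq H bI hβ1 WC hWC rG rC M a hrG hrC hGDsup hCsup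
  have hM' : 0 < max M MT := lt_max_of_lt_left hM
  obtain ⟨ML, hsup⟩ := hD2sup_of_transpose_schemas_w q hq H 𝔠 𝔬12 bI hbI0 hblk12
    (fun x U => (CcoK x.toKIdx (trBasis N) (bg9Y (Matrix (Fin N) (Fin N) ℂ) (specialUnitaryUnits (Fin N)) x) (fun U => U)
        (parSymY x.toKIdx) (parBY x.toKIdx) (GpY x.toKIdx (parSymY x.toKIdx)) U ∘ₗ
      QcoKH x.toKIdx (trBasis N) (bg9Y (Matrix (Fin N) (Fin N) ℂ) (specialUnitaryUnits (Fin N)) x) (fun U => U) (parBY x.toKIdx) U) ∘ₗ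
      GcoK x.toKIdx (trBasis N) (bg9Y (Matrix (Fin N) (Fin N) ℂ) (specialUnitaryUnits (Fin N)) x) (fun U => U)
        (GDY x.toKIdx (parSymY x.toKIdx) (parBY x.toKIdx) (GpY x.toKIdx (parSymY x.toKIdx))) U)
    WC hWC wC hwC hww κC δC cJ _ ((1 - q.α) * q.δ₀) ρR tHJ δ₂ θ₂ (max M MT) a hκC hcJ (BT_nonneg q hq hrG hrC) hρR hδ₂ hM' ha1 hδC hρ htHJ hθ₂
    (fun x hMx α₀ hα ha U hU hU' => hC2 x ((le_max_left _ _).trans hMx) α₀ hα ha U hU hU')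
    (fun x hMx α₀ hα ha U hU hU' => hHT x ((le_max_right _ _).trans hMx) ((le_max_left _ _).trans hMx) α₀ hα ha U hU hU')
    (fun x hMx α₀ hα ha U hU hU' => hreg x ((le_max_left _ _).trans hMx) α₀ hα ha U hU hU')
  exact ⟨max ML MT, fun x hMx hMM α₀ hα ha U hU hU' =>
    hsup x ((le_max_left _ _).trans hMx) (max_le hMM ((le_max_right _ _).trans hMx)) α₀ hα ha U hU hU'⟩

end Summit.QuantumFields.YangMills.BalabanUVNodes.N06HTransposeAtPinsPhys

end
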